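import Literature.NumberTheory.Automorphic.ArchCartanNormalisers     -- ★ (COORD): `RegS ∕ InRegS`, `flipAt ∕ negXAt ∕ angleShift`, `archRH` and its flip character ∕ evenness
import Mathlib.Topology.ExtendFrom
import Mathlib.Data.Finset.SymmDiff
import HarnessLib

/-!
# Stable sums over the flips of a Cartan chart — the GROUP-FREE half of the stable orbital family `Ψfam`, part 1 of 2
# (Shelstad 1979 §4 pp. 22–26; Bouaziz 1994 §6.2 p. 591; Rogawski 1990 §4.1 (4.1.1))

Topic `NumberTheory/Automorphic`; namespace `Literature.NumberTheory.Automorphic.ArchCartan`.  Definitions WITH BODIES and theorems only (no instance, no notation, no axiom,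
no named fact, no `sorry`).  Cell `pub/hodgecm-mathlib`, line LH3 (closer stub `stub_N9`, crux H413 = `stmt-HodgeConjecture-24833`); organ **(D2-P3a)** of the LH3 direct road
(LH3-p01 (g3) DEFAULT 2026-09-02 ≈05:55Z under PACK-SPEC v1 §2, answering the `extendFrom` DECISION there): everything about the stable orbital family
`stOrbFamH νH fH S = R_S · Σ_{flips} chartOrbH …` that does NOT need the group — so that PART 3 proper is the one-liner
`stOrbFamH νH fH S := bzExtend S (fun c => archRH S c * stableSum S (chartOrbH νH S fH) c)` once (T-MEAS) `chartOrbH` (LH2-p04) is ★.  Author LH3-p01 (g3).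

DESIGN.  On the chart `S` (split places `S`), in the coordinates of ★ (COORD):
* `flipSet T c` flips `θ₀ ↔ θ₂` at the places of `T`; for `T ⊆ Sᶜ` these are the points of the chart STABLY conjugate to `c` (★ `injective_conjClassesMk_flip`:
  `2^{#compact places}` classes; at a split place the reflection `x ↦ −x` is REALISED, so it contributes no term).
* `stableSum S Φ c := Σ_{T ⊆ univ ∖ S} Φ (flipSet T c)` — the stable sum of a chart functional `Φ` (for `Φ = chartOrbH νH S fH` this is `Φ^st` up to the frame scalar (CUR)).
  It is FLIP-INVARIANT (`stableSum_flipAt`, reindex `T ↦ T ∆ {w}`), inherits `x ↦ −x` evenness and angle periodicity from `Φ`, and continuity on `RegS S`.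
* `bzExtend S F := (InRegS S).indicator (extendFrom (RegS S) F)` — THE WALL EXTENSION: on the open set `RegS S` it is `F` (for `F` continuous there); at a REAL wall `x_w = 0`
  (in `InRegS S ∖ RegS S`) it is the limit of `F` from the regular set WHEN IT EXISTS (for `F = R_S·Φ^st` of a test function it does — Harish-Chandra's `F_f^A(1)`; that is the
  letter's clause (I₁)+(I₂), NOT assumed here); at the imaginary walls it is `0`.  KEY POINT: the symmetry clauses (P), (W) of ★ `ArchBouazizSpaceH` hold for `bzExtend S F` WITHOUT
  any limit existing — `extendFrom A F x` depends only on the filter `(𝓝[A] x).map F` (`extendFrom_eq_of_map_nhdsWithin_eq`), so every homeomorphism of the coordinate space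
  preserving `RegS S` and `F` on it transports `bzExtend` (`extendFrom_apply_homeomorph`), and the division-free FLIP clause is trivial off `RegS S` (imaginary wall: both sides `0`;
  real wall: `archRH S` vanishes at `c` and at `flipAt w c`).
THIS FILE (part 1): `flipSet`, `stableSum` and their symmetries ∕ continuity (`stableSum_flipAt`, `stableSum_negXAt`, `stableSum_add_angleShift`, `continuousOn_stableSum`),
`continuous_archRH`, `archRH_flipSet`, `archRH_eq_zero_of_apply_eq_zero`.  The wall extension `bzExtend` and its transported symmetries are part 2, ★ `ArchCartanWallExtension`.
HONEST LABEL: HC_CM is proved only modulo the 7 printed citations (2 remaining: hLiu418 = stmt-HodgeConjecture-24832, h413 = stmt-HodgeConjecture-24833) until rung 0 closes;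
coordinate bookkeeping, pays nothing by itself.

## References
* [Shelstad1979] D. Shelstad, *Characters and inner forms of a quasi-split group over ℝ*, Compositio Math. 39 (1979), §4 pp. 22–26 (`Φ^{T,1}_f`, (I)–(III), the stable sum over
  `𝒟(T)`, the real walls).
* [Bouaziz1994IntegralesOrbitales] A. Bouaziz, *Intégrales orbitales sur les groupes de Lie réductifs*, Ann. Sci. ÉNS 27 (1994) 573–609, §3.1 p. 579 ((I₂): `b_Ψ φ` extends `C^∞`
  across `H_{Ψ-reg}`), §6.2 p. 591 (`ψ^{st}`, `T^st_{in-reg}`).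
* [Rogawski1990] J. D. Rogawski, *Automorphic Representations of Unitary Groups in Three Variables*, Ann. of Math. Stud. 123 (1990), §3.7 Prop. 3.7.1 pp. 29–30 (classes in a
  stable class), §4.1 (4.1.1) p. 39 (`Φ^st`).
-/

set_option autoImplicit false

noncomputable section

open Filter Topology Complex Set Function Real

namespace Literature.NumberTheory.Automorphic.ArchCartan

variable {W : Type*}

/-! ## §1 Flipping a set of places -/

section FlipSet

variable [DecidableEq W]

/-- **`flipSet T c`** — flip `θ₀ ↔ θ₂` at every place of `T` (the stable, non-realised Weyl reflections of the compact 2-blocks; ★ `flipAt` is `T = {w}`).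
[cite: Rogawski1990, §3.7 Prop. 3.7.1 pp. 29–30] [cite: Shelstad1979, §4 p. 23] -/
def flipSet (T : Finset W) (c : W → Fin 3 → ℝ) : W → Fin 3 → ℝ :=
  fun w => if w ∈ T then ![c w 2, c w 1, c w 0] else c w

/-- `flipSet` at a flipped place. [cite: Shelstad1979, §4 p. 23] -/
theorem flipSet_apply_of_mem {T : Finset W} {w : W} (h : w ∈ T) (c : W → Fin 3 → ℝ) : flipSet T c w = ![c w 2, c w 1, c w 0] := by
  rw [flipSet, if_pos h]

/-- `flipSet` at an untouched place. [cite: Shelstad1979, §4 p. 23] -/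
theorem flipSet_apply_of_not_mem {T : Finset W} {w : W} (h : w ∉ T) (c : W → Fin 3 → ℝ) : flipSet T c w = c w := by
  rw [flipSet, if_neg h]

/-- `flipSet ∅ = id`. [cite: Shelstad1979, §4 p. 23] -/
@[simp] theorem flipSet_empty (c : W → Fin 3 → ℝ) : flipSet ∅ c = c := by
  funext w
  exact flipSet_apply_of_not_mem (Finset.notMem_empty w) c

omit [DecidableEq W] in
/-- Flipping twice the triple `(a, b, d) ↦ (d, b, a)` is the identity. [cite: Shelstad1979, §4 p. 23] -/
theorem vec3_flip_flip (v : Fin 3 → ℝ) : (![(![v 2, v 1, v 0] : Fin 3 → ℝ) 2, (![v 2, v 1, v 0] : Fin 3 → ℝ) 1, (![v 2, v 1, v 0] : Fin 3 → ℝ) 0] : Fin 3 → ℝ) = v := by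
  funext i
  fin_cases i
  · simp
  · simp
  · simp

/-- `flipSet T` is an involution. [cite: Shelstad1979, §4 p. 23] -/
theorem flipSet_flipSet (T : Finset W) (c : W → Fin 3 → ℝ) : flipSet T (flipSet T c) = c := by
  funext w
  by_cases h : w ∈ T
  · rw [flipSet_apply_of_mem h, flipSet_apply_of_mem h, vec3_flip_flip]
  · rw [flipSet_apply_of_not_mem h, flipSet_apply_of_not_mem h]

/-- **One more flip toggles the place**: `flipSet T (flipAt w c) = flipSet (T ∆ {w}) c`. [cite: Rogawski1990, §3.7 Prop. 3.7.1 pp. 29–30] -/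
theorem flipSet_flipAt (T : Finset W) (w : W) (c : W → Fin 3 → ℝ) : flipSet T (flipAt w c) = flipSet (symmDiff T {w}) c := by
  funext w'
  by_cases hw : w' = w
  · subst hw
    by_cases hT : w' ∈ T
    · have hn : w' ∉ symmDiff T {w'} := by
        rw [Finset.mem_symmDiff]
        rintro (⟨_, h⟩ | ⟨_, h⟩)
        · exact h (Finset.mem_singleton_self w')
        · exact h hT
      rw [flipSet_apply_of_mem hT, flipSet_apply_of_not_mem hn, flipAt_apply_self, vec3_flip_flip]
    · have hy : w' ∈ symmDiff T {w'} := by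
        rw [Finset.mem_symmDiff]
        exact Or.inr ⟨Finset.mem_singleton_self w', hT⟩
      rw [flipSet_apply_of_not_mem hT, flipSet_apply_of_mem hy, flipAt_apply_self]
  · have hiff : w' ∈ symmDiff T {w} ↔ w' ∈ T := by
      rw [Finset.mem_symmDiff, Finset.mem_singleton]
      constructor
      · rintro (⟨h, _⟩ | ⟨h, _⟩)
        · exact h
        · exact absurd h hw
      · intro h
        exact Or.inl ⟨h, hw⟩
    by_cases hT : w' ∈ T
    · rw [flipSet_apply_of_mem hT, flipSet_apply_of_mem (hiff.2 hT), flipAt_apply_of_ne hw]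
    · rw [flipSet_apply_of_not_mem hT, flipSet_apply_of_not_mem (fun h => hT (hiff.1 h)), flipAt_apply_of_ne hw]

/-- `flipSet {w} = flipAt w`. [cite: Shelstad1979, §4 p. 23] -/
theorem flipSet_singleton (w : W) (c : W → Fin 3 → ℝ) : flipSet {w} c = flipAt w c := by
  funext w'
  by_cases hw : w' = w
  · subst hw
    rw [flipSet_apply_of_mem (Finset.mem_singleton_self w'), flipAt_apply_self]
  · rw [flipSet_apply_of_not_mem (fun h => hw (Finset.mem_singleton.1 h)), flipAt_apply_of_ne hw]

/-- Flipping compact places preserves `RegS S` (the wall `e^{iθ₀} = e^{iθ₂}` is flip-symmetric; split slots untouched). [cite: Shelstad1979, §4 p. 22] -/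
theorem flipSet_mem_regS_iff (S : Finset W) {T : Finset W} (hT : ∀ w ∈ T, w ∉ S) (c : W → Fin 3 → ℝ) : flipSet T c ∈ RegS S ↔ c ∈ RegS S := by
  simp only [mem_regS_iff]
  refine and_congr (forall_congr' fun w => forall_congr' fun _ => ?_) (forall_congr' fun w => forall_congr' fun hw => ?_)
  · by_cases h : w ∈ T
    · rw [flipSet_apply_of_mem h]
      simp only [Matrix.cons_val_zero, Matrix.cons_val_two, Matrix.tail_cons, Matrix.head_cons]
      exact ne_comm
    · rw [flipSet_apply_of_not_mem h]
  · have h : w ∉ T := fun h => hT w h hw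
    rw [flipSet_apply_of_not_mem h]

/-- Flipping places preserves `InRegS S`. [cite: Bouaziz1994IntegralesOrbitales, §6.2 p. 591] -/
theorem flipSet_mem_inRegS_iff (S : Finset W) (T : Finset W) (c : W → Fin 3 → ℝ) : flipSet T c ∈ InRegS S ↔ c ∈ InRegS S := by
  simp only [mem_inRegS_iff]
  refine forall_congr' fun w => forall_congr' fun _ => ?_
  by_cases h : w ∈ T
  · rw [flipSet_apply_of_mem h]
    simp only [Matrix.cons_val_zero, Matrix.cons_val_two, Matrix.tail_cons, Matrix.head_cons]
    exact ne_comm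
  · rw [flipSet_apply_of_not_mem h]

/-- `flipAt w` preserves `InRegS S` (any `w`). [cite: Bouaziz1994IntegralesOrbitales, §6.2 p. 591] -/
theorem flipAt_mem_inRegS_iff (S : Finset W) (w : W) (c : W → Fin 3 → ℝ) : flipAt w c ∈ InRegS S ↔ c ∈ InRegS S := by
  rw [← flipSet_singleton, flipSet_mem_inRegS_iff]

/-- `negXAt w` at a split place preserves `InRegS S` (which does not read the split places). [cite: Bouaziz1994IntegralesOrbitales, §6.2 p. 591] -/
theorem negXAt_mem_inRegS_iff (S : Finset W) {w : W} (hw : w ∈ S) (c : W → Fin 3 → ℝ) : negXAt w c ∈ InRegS S ↔ c ∈ InRegS S := by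
  simp only [mem_inRegS_iff]
  refine forall_congr' fun w' => forall_congr' fun hw' => ?_
  have hne : w' ≠ w := fun h => hw' (by rw [h]; exact hw)
  rw [negXAt_apply_of_ne hne]

/-- `flipSet T` commutes with `negXAt w` for `w ∉ T`. [cite: Shelstad1979, §4 p. 23] -/
theorem flipSet_negXAt_of_not_mem {T : Finset W} {w : W} (h : w ∉ T) (c : W → Fin 3 → ℝ) : flipSet T (negXAt w c) = negXAt w (flipSet T c) := by
  funext w'
  by_cases hw : w' = w
  · subst hw
    rw [flipSet_apply_of_not_mem h, negXAt_apply_self, negXAt_apply_self, flipSet_apply_of_not_mem h]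
  · rw [negXAt_apply_of_ne hw]
    by_cases hT : w' ∈ T
    · rw [flipSet_apply_of_mem hT, flipSet_apply_of_mem hT, negXAt_apply_of_ne hw]
    · rw [flipSet_apply_of_not_mem hT, flipSet_apply_of_not_mem hT, negXAt_apply_of_ne hw]

/-- The slot permutation `0 ↔ 2` induced by a flip on the shift index. [cite: Shelstad1979, §4 p. 22] -/
def flipSlot (i : Fin 3) : Fin 3 := ![2, 1, 0] i

omit [DecidableEq W] in
/-- `flipSlot` never sends a non-zero… more precisely: `flipSlot i = 0 ↔ i = 2`. [cite: Shelstad1979, §4 p. 22] -/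
theorem flipSlot_eq_zero_iff (i : Fin 3) : flipSlot i = 0 ↔ i = 2 := by
  fin_cases i <;> simp [flipSlot]

/-- `flipSet T` carries the angle shift at slot `(w, i)` to the angle shift at the flipped slot when `w ∈ T`. [cite: Shelstad1979, §4 p. 22] -/
theorem flipSet_add_angleShift_of_mem {T : Finset W} (c : W → Fin 3 → ℝ) {w : W} (hw : w ∈ T) (i : Fin 3) (k : ℤ) :
    flipSet T (c + angleShift w i k) = flipSet T c + angleShift w (flipSlot i) k := by
  funext w' j
  rw [Pi.add_apply, Pi.add_apply]
  by_cases hw' : w' = w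
  · subst hw'
    rw [flipSet_apply_of_mem hw, flipSet_apply_of_mem hw]
    fin_cases i <;> fin_cases j <;>
      simp [flipSlot, Pi.add_apply, angleShift_apply_self, angleShift_apply_self_of_ne]
  · rw [angleShift_apply_of_ne hw', Pi.zero_apply, add_zero]
    by_cases hT : w' ∈ T
    · rw [flipSet_apply_of_mem hT, flipSet_apply_of_mem hT]
      simp only [Pi.add_apply, angleShift_apply_of_ne hw', Pi.zero_apply, add_zero]
    · rw [flipSet_apply_of_not_mem hT, flipSet_apply_of_not_mem hT, Pi.add_apply, angleShift_apply_of_ne hw', add_zero]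

/-- `flipSet T` commutes with the angle shifts at the untouched places. [cite: Shelstad1979, §4 p. 22] -/
theorem flipSet_add_angleShift_of_not_mem {T : Finset W} (c : W → Fin 3 → ℝ) {w : W} (hw : w ∉ T) (i : Fin 3) (k : ℤ) :
    flipSet T (c + angleShift w i k) = flipSet T c + angleShift w i k := by
  funext w' j
  rw [Pi.add_apply, Pi.add_apply]
  by_cases hw' : w' = w
  · subst hw'
    rw [flipSet_apply_of_not_mem hw, flipSet_apply_of_not_mem hw, Pi.add_apply, Pi.add_apply]
  · rw [angleShift_apply_of_ne hw', Pi.zero_apply, add_zero]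
    by_cases hT : w' ∈ T
    · rw [flipSet_apply_of_mem hT, flipSet_apply_of_mem hT]
      simp only [Pi.add_apply, angleShift_apply_of_ne hw', Pi.zero_apply, add_zero]
    · rw [flipSet_apply_of_not_mem hT, flipSet_apply_of_not_mem hT, Pi.add_apply, angleShift_apply_of_ne hw', add_zero]

end FlipSet

section FlipSetTop

variable [Fintype W] [DecidableEq W]

omit [Fintype W] in
/-- `flipSet T` is continuous. [cite: Shelstad1979, §4 p. 23] -/
theorem continuous_flipSet (T : Finset W) : Continuous (flipSet T : (W → Fin 3 → ℝ) → W → Fin 3 → ℝ) := by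
  refine continuous_pi fun w => ?_
  by_cases h : w ∈ T
  · simp only [flipSet, if_pos h]
    have h0 : Continuous fun a : W → Fin 3 → ℝ => a w 0 := (continuous_apply 0).comp (continuous_apply w)
    have h1 : Continuous fun a : W → Fin 3 → ℝ => a w 1 := (continuous_apply 1).comp (continuous_apply w)
    have h2 : Continuous fun a : W → Fin 3 → ℝ => a w 2 := (continuous_apply 2).comp (continuous_apply w)
    refine continuous_pi fun j => ?_
    fin_cases j
    · simpa using h2
    · simpa using h1
    · simpa using h0
  · simp only [flipSet, if_neg h]
    exact continuous_apply w

/-- `negXAt w` is continuous. [cite: Shelstad1979, §4 p. 23] -/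
theorem continuous_negXAt (w : W) : Continuous (negXAt w : (W → Fin 3 → ℝ) → W → Fin 3 → ℝ) :=
  (contDiff_negXAt w).continuous

/-- `flipAt w` is continuous. [cite: Shelstad1979, §4 p. 23] -/
theorem continuous_flipAt (w : W) : Continuous (flipAt w : (W → Fin 3 → ℝ) → W → Fin 3 → ℝ) :=
  (contDiff_flipAt w).continuous

/-- `R_T` is continuous in the coordinates. [cite: Shelstad1979, §4 p. 22] -/
theorem continuous_archRH (S : Finset W) : Continuous (archRH S : (W → Fin 3 → ℝ) → ℂ) := by
  unfold archRH
  refine continuous_finsetProd _ fun w _ => ?_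
  have h0 : Continuous fun c : W → Fin 3 → ℝ => c w 0 := (continuous_apply 0).comp (continuous_apply w)
  have h2 : Continuous fun c : W → Fin 3 → ℝ => c w 2 := (continuous_apply 2).comp (continuous_apply w)
  by_cases hw : w ∈ S
  · simp only [if_pos hw]
    exact Complex.continuous_ofReal.comp (continuous_abs.comp ((Real.continuous_exp.comp h0).sub (Real.continuous_exp.comp h0.neg)))
  · simp only [if_neg hw]
    exact continuous_const.sub (continuous_subtype_val.comp (Circle.exp.continuous.comp (h2.sub h0)))

/-- `R_T` vanishes when a split coordinate vanishes (a real wall point). [cite: Shelstad1979, §4 p. 22] -/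
theorem archRH_eq_zero_of_apply_eq_zero (S : Finset W) {w : W} (hw : w ∈ S) {c : W → Fin 3 → ℝ} (h : c w 0 = 0) : archRH S c = 0 := by
  unfold archRH
  refine Finset.prod_eq_zero (Finset.mem_univ w) ?_
  rw [if_pos hw, h, neg_zero, sub_self, abs_zero, Complex.ofReal_zero]

omit [Fintype W] [DecidableEq W] in
/-- A point of `InRegS S` off `RegS S` lies on a REAL wall: some split coordinate vanishes. [cite: Bouaziz1994IntegralesOrbitales, §6.2 p. 591] -/
theorem exists_apply_eq_zero_of_mem_inRegS_of_not_mem_regS (S : Finset W) {c : W → Fin 3 → ℝ} (h1 : c ∈ InRegS S) (h2 : c ∉ RegS S) : ∃ w ∈ S, c w 0 = 0 := by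
  by_contra h
  exact h2 ⟨h1, fun w hw hc => h ⟨w, hw, hc⟩⟩

/-- **`R_T` under a set of flips**: a UNIT times `R_T` (product of the flip characters ★ `archRH_flipAt`). [cite: Shelstad1979, §4 p. 23] -/
theorem archRH_flipSet (S : Finset W) (T : Finset W) (hT : ∀ w ∈ T, w ∉ S) (c : W → Fin 3 → ℝ) :
    archRH S (flipSet T c) = (∏ w ∈ T, -(Circle.exp (c w 0 - c w 2) : ℂ)) * archRH S c := by
  induction T using Finset.induction_on generalizing c with
  | empty => rw [flipSet_empty, Finset.prod_empty, one_mul]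
  | insert w T hw ih =>
    have hT' : ∀ w' ∈ T, w' ∉ S := fun w' h => hT w' (Finset.mem_insert_of_mem h)
    have hwS : w ∉ S := hT w (Finset.mem_insert_self w T)
    have hflip : flipSet (insert w T) c = flipSet T (flipAt w c) := by
      rw [flipSet_flipAt]
      congr 1
      ext w'
      rw [Finset.mem_insert, Finset.mem_symmDiff, Finset.mem_singleton]
      constructor
      · rintro (rfl | h)
        · exact Or.inr ⟨rfl, hw⟩
        · exact Or.inl ⟨h, fun h' => hw (h' ▸ h)⟩
      · rintro (⟨h, _⟩ | ⟨h, _⟩)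
        · exact Or.inr h
        · exact Or.inl h
    have hprod : ∏ w' ∈ T, -(Circle.exp ((flipAt w c) w' 0 - (flipAt w c) w' 2) : ℂ) = ∏ w' ∈ T, -(Circle.exp (c w' 0 - c w' 2) : ℂ) :=
      Finset.prod_congr rfl fun w' hw' => by rw [flipAt_apply_of_ne (fun h => hw (by rw [← h]; exact hw'))]
    rw [hflip, ih hT' (flipAt w c), archRH_flipAt S hwS c, hprod, Finset.prod_insert hw]
    ring

end FlipSetTop

/-! ## §2 The stable sum over the flips of the compact places -/

section StableSum

variable [Fintype W] [DecidableEq W]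

/-- **`stableSum S Φ c = Σ_{T ⊆ univ ∖ S} Φ (flipSet T c)`** — the sum of a chart functional over the points of the chart of type `S` stably conjugate to `c`: the `2^{#compact places}`
flips at the compact places (at the split places the reflection is realised, ★ `injective_conjClassesMk_flip`; print: `Φ^st(γ, f) = Σ_{[γ′] ⊂ 𝒪_st(γ)} Φ(γ′, f)`, `𝒟(T)` of
Shelstad). [cite: Rogawski1990, §4.1 (4.1.1) p. 39; §3.7 Prop. 3.7.1 pp. 29–30] [cite: Shelstad1979, §4 p. 23] -/
def stableSum (S : Finset W) (Φ : (W → Fin 3 → ℝ) → ℂ) (c : W → Fin 3 → ℝ) : ℂ :=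
  ∑ T ∈ (Finset.univ \ S).powerset, Φ (flipSet T c)

/-- Unfolding of `stableSum`. [cite: Rogawski1990, §4.1 (4.1.1) p. 39] -/
theorem stableSum_def (S : Finset W) (Φ : (W → Fin 3 → ℝ) → ℂ) (c : W → Fin 3 → ℝ) :
    stableSum S Φ c = ∑ T ∈ (Finset.univ \ S).powerset, Φ (flipSet T c) :=
  rfl

/-- Members of the index set flip compact places only. [cite: Rogawski1990, §3.7 Prop. 3.7.1 pp. 29–30] -/
theorem not_mem_of_mem_powerset_sdiff {S T : Finset W} (hT : T ∈ (Finset.univ \ S).powerset) : ∀ w ∈ T, w ∉ S :=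
  fun _ hw => (Finset.mem_sdiff.1 (Finset.mem_powerset.1 hT hw)).2

/-- **THE STABLE SUM IS FLIP-INVARIANT**: `stableSum S Φ (flipAt w c) = stableSum S Φ c` for a compact place `w ∉ S` (reindex `T ↦ T ∆ {w}`, an involution of the index set).
[cite: Shelstad1979, §4 p. 23] [cite: Rogawski1990, §4.1 p. 40] -/
theorem stableSum_flipAt (S : Finset W) (Φ : (W → Fin 3 → ℝ) → ℂ) {w : W} (hw : w ∉ S) (c : W → Fin 3 → ℝ) :
    stableSum S Φ (flipAt w c) = stableSum S Φ c := by
  unfold stableSum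
  simp_rw [flipSet_flipAt]
  have hmem : ∀ T ∈ (Finset.univ \ S).powerset, symmDiff T {w} ∈ (Finset.univ \ S).powerset := by
    intro T hT
    rw [Finset.mem_powerset] at hT ⊢
    intro x hx
    rw [Finset.mem_symmDiff, Finset.mem_singleton] at hx
    rcases hx with ⟨h, _⟩ | ⟨rfl, _⟩
    · exact hT h
    · exact Finset.mem_sdiff.2 ⟨Finset.mem_univ _, hw⟩
  exact Finset.sum_nbij' (fun T => symmDiff T {w}) (fun T => symmDiff T {w}) hmem hmem
    (fun T _ => symmDiff_symmDiff_cancel_right {w} T) (fun T _ => symmDiff_symmDiff_cancel_right {w} T) (fun T _ => rfl)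

/-- The stable sum inherits the REALISED symmetry `x ↦ −x` at a split place from `Φ` (on `RegS S`). [cite: Shelstad1979, §4 p. 23] -/
theorem stableSum_negXAt (S : Finset W) {Φ : (W → Fin 3 → ℝ) → ℂ} {w : W} (hw : w ∈ S) (hΦ : ∀ c ∈ RegS S, Φ (negXAt w c) = Φ c)
    {c : W → Fin 3 → ℝ} (hc : c ∈ RegS S) : stableSum S Φ (negXAt w c) = stableSum S Φ c := by
  unfold stableSum
  refine Finset.sum_congr rfl fun T hT => ?_
  have hT' := not_mem_of_mem_powerset_sdiff hT
  rw [flipSet_negXAt_of_not_mem (fun h => hT' w h hw), hΦ _ ((flipSet_mem_regS_iff S hT' c).2 hc)]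

/-- The stable sum inherits angle-periodicity from `Φ` (on `RegS S`; the flipped slot is again an angle slot). [cite: Shelstad1979, §4 p. 22] -/
theorem stableSum_add_angleShift (S : Finset W) {Φ : (W → Fin 3 → ℝ) → ℂ}
    (hΦ : ∀ c ∈ RegS S, ∀ (w : W) (i : Fin 3) (k : ℤ), (w ∉ S ∨ i ≠ 0) → Φ (c + angleShift w i k) = Φ c)
    {c : W → Fin 3 → ℝ} (hc : c ∈ RegS S) {w : W} {i : Fin 3} (h : w ∉ S ∨ i ≠ 0) (k : ℤ) :
    stableSum S Φ (c + angleShift w i k) = stableSum S Φ c := by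
  unfold stableSum
  refine Finset.sum_congr rfl fun T hT => ?_
  have hT' := not_mem_of_mem_powerset_sdiff hT
  have hcT : flipSet T c ∈ RegS S := (flipSet_mem_regS_iff S hT' c).2 hc
  by_cases hwT : w ∈ T
  · rw [flipSet_add_angleShift_of_mem c hwT]
    exact hΦ _ hcT w (flipSlot i) k (Or.inl (hT' w hwT))
  · rw [flipSet_add_angleShift_of_not_mem c hwT]
    exact hΦ _ hcT w i k h

/-- The stable sum is continuous on `RegS S` when `Φ` is. [cite: Shelstad1979, §4 p. 23] -/
theorem continuousOn_stableSum (S : Finset W) {Φ : (W → Fin 3 → ℝ) → ℂ} (hΦ : ContinuousOn Φ (RegS S)) : ContinuousOn (stableSum S Φ) (RegS S) := by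
  unfold stableSum
  refine continuousOn_finsetSum _ fun T hT => ?_
  exact hΦ.comp (continuous_flipSet T).continuousOn fun c hc => (flipSet_mem_regS_iff S (not_mem_of_mem_powerset_sdiff hT) c).2 hc

end StableSum

end Literature.NumberTheory.Automorphic.ArchCartan

end
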